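import Literature.NumberTheory.Transcendental.GaGmSectionComponents
import HarnessLib

/-!
# Lower bound for the box multiplicity of a connected subgroup of `G = 𝔾ₐ × 𝔾ₘⁿ` (general rank)

Topic `Literature/NumberTheory/Transcendental`. For an irreducible closed subgroup
`H = V × T_A ≤ ℂ × (ℂˣ)ⁿ` (`d₀ = dim V ∈ {0, 1}`, `k = dim T_A`) and box degrees `D₀, D₁ ≥ 1` we
PROVE the lower bound

`(dim H)! · D₀^{d₀} · D₁^{k} · ∑_{J ⊆ {1..n}, #J = k} #(H ∩ {x = 0, y_j = 1 (j ∈ J)}) ≤ mult_{D₀,D₁}(H)`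

(`GaGm.factorial_mul_sum_slice_le_mult`; `#` = `Set.ncard`, infinite slices count `0`). The slice
counts `#(H ∩ {x = 0, y_J = 1}) = #(T_A ∩ T_{ℤ^J}) = [ℤⁿ : A + ℤ^J] = |det M_{Jᶜ}|` (for a basis
matrix `M` of `A`) are the maximal minors in Philippon's value
`𝓗(V × T_A; D) = (dim)! · D₀^{d₀} · ∑_I |det M_I| · ∏_{j ∉ I} D_j` of the multihomogeneous
Hilbert–Samuel polynomial of the closure of `V × T_A` in `(ℙ¹)ⁿ⁺¹` (Philippon 1986, §3, (*) p. 362 and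
Lemme 3.4; Nesterenko 2003, (5.7)), here at equal torus degrees `D_j = D₁`; this general-rank bound
replaces the rank-one count of `PhilipponZeroEstimateP1nMultBound.lean`.

Proof: induction on `dim H`, cutting `H` by the box-degree-one hypersurface
`F = ∏_{i < D₀} (X - aᵢ) · ∏_{h good} ∏_{i < D₁} (Y_h - c_{h,i})` through generic section points
(`GaGmSectionData`, `GaGmSectionComponents`): by Bézout (`GaGm.section_sum_le_mult`)
`D₀ · #(K_0/K_0°) · mult(K_0°) + ∑_h D₁ · #(K_h/K_h°) · mult(K_h°) ≤ mult(H)` for the level subgroups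
`K_c`, the induction hypothesis applies to the `K_c°` (dimension `dim H - 1`, additive dimension
`0` resp. `d₀`), the slice counts of `H` are at most `#(K_c/K_c°)` times those of `K_c°`
(`GaGm.ncard_inter_slice_le`), degenerate slices vanish (`GaGm.ncard_inter_slice_eq_zero`), and
`∑_h ∑_{J' ∌ h} = k · ∑_J` supplies the factor `dim H = d₀ + k`.

## References

* P. Philippon, *Lemmes de zéros dans les groupes algébriques commutatifs*, Bull. Soc. Math.
  France 114 (1986), 355–383, §3 ((*) p. 362, Prop. 3.3, Lemme 3.4). [Philippon1986]
* Yu. V. Nesterenko, *Linear forms in logarithms of rational numbers*, LNM 1819 (2003), §5.1,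
  (5.7) and Prop. 5.1. [Nesterenko2003]
-/

noncomputable section

open MvPolynomial Module
open scoped Pointwise

namespace Literature.NumberTheory.Transcendental

namespace GaGm

variable {n : ℕ}

/-! ### The additive part of `toConnAlgSubgroup` -/

/-- `V = 𝔾ₐ` iff `(1, 1) ∈ H`. [cite: Borel1991, §8.5] -/
theorem addPart_toConnAlgSubgroup_iff (K : Subgroup (GaGm n)) (hK : IsIrred (K : Set (GaGm n))) :
    (toConnAlgSubgroup K hK).addPart = true ↔
      ((Multiplicative.ofAdd (1 : ℂ), (1 : Fin n → ℂˣ)) : GaGm n) ∈ K := by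
  classical
  simp [toConnAlgSubgroup]

open Classical in
/-- `dim V = 1` if `(1,1) ∈ H`, else `0`. [cite: Borel1991, §8.5] -/
theorem addDim_toConnAlgSubgroup_eq (K : Subgroup (GaGm n)) (hK : IsIrred (K : Set (GaGm n))) :
    (toConnAlgSubgroup K hK).addDim =
      if ((Multiplicative.ofAdd (1 : ℂ), (1 : Fin n → ℂˣ)) : GaGm n) ∈ K then 1 else 0 := by
  classical
  rw [ConnAlgSubgroup.addDim]
  by_cases h : ((Multiplicative.ofAdd (1 : ℂ), (1 : Fin n → ℂˣ)) : GaGm n) ∈ K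
  · rw [if_pos ((addPart_toConnAlgSubgroup_iff K hK).mpr h), if_pos h]
  · rw [if_neg h, if_neg (fun h' => h ((addPart_toConnAlgSubgroup_iff K hK).mp h'))]

/-! ### A combinatorial identity -/

/-- `∑_{h ∈ G} ∑_{#J' = k, h ∉ J'} f(J' ∪ {h}) = ∑_{#J = k+1} #(J ∩ G) · f(J)`.
[cite: Philippon1986, §3 Lemme 3.1] -/
theorem sum_sum_insert_eq (G : Finset (Fin n)) (k : ℕ) (f : Finset (Fin n) → ℕ) :
    ∑ h ∈ G, ∑ J' ∈ ((Finset.univ : Finset (Fin n)).powersetCard k).filter (fun J' => h ∉ J'), f (insert h J') =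
      ∑ J ∈ (Finset.univ : Finset (Fin n)).powersetCard (k + 1), (J ∩ G).card * f J := by
  classical
  have hinner : ∀ h : Fin n,
      ∑ J' ∈ ((Finset.univ : Finset (Fin n)).powersetCard k).filter (fun J' => h ∉ J'), f (insert h J') =
        ∑ J ∈ ((Finset.univ : Finset (Fin n)).powersetCard (k + 1)).filter (fun J => h ∈ J), f J := by
    intro h
    refine Finset.sum_nbij' (fun J' => insert h J') (fun J => J.erase h) ?_ ?_ ?_ ?_ ?_
    · intro J' hJ'
      rw [Finset.mem_filter, Finset.mem_powersetCard] at hJ' ⊢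
      exact ⟨⟨Finset.subset_univ _, by rw [Finset.card_insert_of_notMem hJ'.2, hJ'.1.2]⟩,
        Finset.mem_insert_self _ _⟩
    · intro J hJ
      rw [Finset.mem_filter, Finset.mem_powersetCard] at hJ ⊢
      refine ⟨⟨Finset.subset_univ _, ?_⟩, Finset.notMem_erase _ _⟩
      rw [Finset.card_erase_of_mem hJ.2, hJ.1.2, Nat.add_sub_cancel]
    · intro J' hJ'
      rw [Finset.mem_filter] at hJ'
      exact Finset.erase_insert hJ'.2
    · intro J hJ
      rw [Finset.mem_filter] at hJ
      exact Finset.insert_erase hJ.2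
    · intro J' _; rfl
  rw [Finset.sum_congr rfl fun h _ => hinner h]
  simp_rw [Finset.sum_filter]
  rw [Finset.sum_comm]
  refine Finset.sum_congr rfl fun J _ => ?_
  rw [← Finset.sum_filter, Finset.sum_const, smul_eq_mul, Finset.filter_mem_eq_inter, Finset.inter_comm]

/-! ### Slices of `H` and of its level subgroups -/

/-- `H ∩ {x = 0, y_J = 1} = K_0 ∩ {x = 0, y_J = 1}` for the level subgroup `K_0 = {g ∈ H ; x(g) = 0}`.
[cite: Borel1991, §8.5] -/
theorem inter_slice_eq_level_zero (H K : Subgroup (GaGm n))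
    (hK : (K : Set (GaGm n)) = {g : GaGm n | g ∈ H ∧ coord g 0 = coord (1 : GaGm n) 0}) (J : Finset (Fin n)) :
    (H : Set (GaGm n)) ∩ {g : GaGm n | g.1 = 1 ∧ ∀ j ∈ J, g.2 j = 1} =
      (K : Set (GaGm n)) ∩ {g : GaGm n | g.1 = 1 ∧ ∀ j ∈ J, g.2 j = 1} := by
  rw [hK]
  ext g
  simp only [Set.mem_inter_iff, Set.mem_setOf_eq, SetLike.mem_coe, coord_zero]
  constructor
  · rintro ⟨hg, h1, h2⟩; exact ⟨⟨hg, by rw [h1]; rfl⟩, h1, h2⟩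
  · rintro ⟨⟨hg, -⟩, h1, h2⟩; exact ⟨hg, h1, h2⟩

/-- `H ∩ {x = 0, y_h = 1, y_{J'} = 1} = K_h ∩ {x = 0, y_{J'} = 1}` for the level subgroup
`K_h = {g ∈ H ; y_h(g) = 1}`. [cite: Borel1991, §8.5] -/
theorem inter_slice_insert_eq_level_succ (H K : Subgroup (GaGm n)) (h : Fin n)
    (hK : (K : Set (GaGm n)) = {g : GaGm n | g ∈ H ∧ coord g h.succ = coord (1 : GaGm n) h.succ})
    (J' : Finset (Fin n)) :
    (H : Set (GaGm n)) ∩ {g : GaGm n | g.1 = 1 ∧ ∀ j ∈ insert h J', g.2 j = 1} =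
      (K : Set (GaGm n)) ∩ {g : GaGm n | g.1 = 1 ∧ ∀ j ∈ J', g.2 j = 1} := by
  classical
  rw [hK]
  ext g
  simp only [Set.mem_inter_iff, Set.mem_setOf_eq, SetLike.mem_coe, coord_succ, Prod.snd_one, Pi.one_apply,
    Units.val_one, Finset.forall_mem_insert, Units.val_eq_one]
  tauto

/-- **Good slices.** If every `h ∉ G` has `y_h ≡ 1` on `H` and `dim T_A = k + 1`, then
`∑_{h ∈ G} ∑_{#J' = k, h ∉ J'} #(H ∩ {x=0, y_{J'∪{h}} = 1}) = (k+1) · ∑_{#J = k+1} #(H ∩ {x=0, y_J=1})`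
(slices through a coordinate outside `G` are degenerate). [cite: Philippon1986, §3 Lemme 3.4] -/
theorem sum_sum_slice_insert_eq (H : Subgroup (GaGm n)) (hirr : IsIrred (H : Set (GaGm n)))
    (G : Finset (Fin n)) (hG : ∀ h ∉ G, Pi.single h (1 : ℤ) ∈ charGroup (H : Set (GaGm n))) {k : ℕ}
    (hk : (toConnAlgSubgroup H hirr).torusDim = k + 1) :
    ∑ h ∈ G, ∑ J' ∈ ((Finset.univ : Finset (Fin n)).powersetCard k).filter (fun J' => h ∉ J'),
        ((H : Set (GaGm n)) ∩ {g : GaGm n | g.1 = 1 ∧ ∀ j ∈ insert h J', g.2 j = 1}).ncard =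
      (k + 1) * ∑ J ∈ (Finset.univ : Finset (Fin n)).powersetCard (k + 1),
        ((H : Set (GaGm n)) ∩ {g : GaGm n | g.1 = 1 ∧ ∀ j ∈ J, g.2 j = 1}).ncard := by
  classical
  rw [sum_sum_insert_eq G k (fun J => ((H : Set (GaGm n)) ∩ {g : GaGm n | g.1 = 1 ∧ ∀ j ∈ J, g.2 j = 1}).ncard),
    Finset.mul_sum]
  refine Finset.sum_congr rfl fun J hJ => ?_
  rw [Finset.mem_powersetCard] at hJ
  by_cases hJG : J ⊆ G
  · rw [Finset.inter_eq_left.mpr hJG, hJ.2]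
  · obtain ⟨h, hhJ, hhG⟩ := Finset.not_subset.mp hJG
    rw [ncard_inter_slice_eq_zero H hirr (hJ.2.trans hk.symm) hhJ (hG h hhG), mul_zero, mul_zero]

/-! ### The main theorem -/

/-- **Lower bound for the multiplicity of a connected subgroup (general rank).** For an irreducible
closed subgroup `H = V × T_A ≤ ℂ × (ℂˣ)ⁿ` and `D₀, D₁ ≥ 1`:
`(dim H)! · D₀^{dim V} · D₁^{dim T_A} · ∑_{#J = dim T_A} #(H ∩ {x = 0, y_J = 1}) ≤ mult_{D₀,D₁}(H)` —
Philippon's value `𝓗(V × T_A; D₀, D₁, …, D₁)` of §3 (*) (the bidegree-`α` degrees of the closure of a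
subtorus in `(ℙ¹)ⁿ` are the slice counts `#(T_A ∩ T_{ℤ^J})`, Lemme 3.4), read as a lower bound for
`GaGm.mult`. [cite: Philippon1986, §3 (*) p. 362 and Lemme 3.4; Nesterenko2003, §5.1 (5.7)] -/
theorem factorial_mul_sum_slice_le_mult {D₀ D₁ : ℕ} (hD₀ : 1 ≤ D₀) (hD₁ : 1 ≤ D₁)
    (H : Subgroup (GaGm n)) (hirr : IsIrred (H : Set (GaGm n))) :
    (dimG (H : Set (GaGm n))).factorial *
      (D₀ ^ (toConnAlgSubgroup H hirr).addDim * (D₁ ^ (toConnAlgSubgroup H hirr).torusDim *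
        ∑ J ∈ (Finset.univ : Finset (Fin n)).powersetCard (toConnAlgSubgroup H hirr).torusDim,
          ((H : Set (GaGm n)) ∩ {g : GaGm n | g.1 = 1 ∧ ∀ j ∈ J, g.2 j = 1}).ncard)) ≤
      mult D₀ D₁ (H : Set (GaGm n)) := by
  classical
  suffices main : ∀ (d : ℕ) (H : Subgroup (GaGm n)) (hirr : IsIrred (H : Set (GaGm n))),
      dimG (H : Set (GaGm n)) = d →
      d.factorial *
        (D₀ ^ (toConnAlgSubgroup H hirr).addDim * (D₁ ^ (toConnAlgSubgroup H hirr).torusDim *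
          ∑ J ∈ (Finset.univ : Finset (Fin n)).powersetCard (toConnAlgSubgroup H hirr).torusDim,
            ((H : Set (GaGm n)) ∩ {g : GaGm n | g.1 = 1 ∧ ∀ j ∈ J, g.2 j = 1}).ncard)) ≤
        mult D₀ D₁ (H : Set (GaGm n)) from main _ H hirr rfl
  intro d
  induction d with
  | zero =>
    -- `dim H = 0`: `H = {e}`, `V = 0`, `k = 0`, the sum is `#{e} = 1 ≤ mult`
    intro H hirr hdim
    have hsub : (H : Set (GaGm n)).Subsingleton := hirr.subsingleton_of_dimG_eq_zero hdim
    have hak := dimG_eq_addDim_add_torusDim H hirr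
    rw [hdim] at hak
    have ha : (toConnAlgSubgroup H hirr).addDim = 0 := by omega
    have hk : (toConnAlgSubgroup H hirr).torusDim = 0 := by omega
    rw [ha, hk, Nat.factorial_zero, pow_zero, pow_zero, one_mul, one_mul, one_mul, Finset.powersetCard_zero,
      Finset.sum_singleton]
    have hset : (H : Set (GaGm n)) ∩ {g : GaGm n | g.1 = 1 ∧ ∀ j ∈ (∅ : Finset (Fin n)), g.2 j = 1} = {1} := by
      ext g
      simp only [Set.mem_inter_iff, SetLike.mem_coe, Set.mem_setOf_eq, Finset.notMem_empty, false_implies,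
        implies_true, and_true, Set.mem_singleton_iff]
      constructor
      · rintro ⟨hg, -⟩; exact hsub hg H.one_mem
      · rintro rfl; exact ⟨H.one_mem, rfl⟩
    rw [hset, Set.ncard_singleton]
    exact (hirr.hasMult hD₀ hD₁).2
  | succ d IH =>
    intro H hirr hdim
    set 𝓗 := toConnAlgSubgroup H hirr with h𝓗def
    have hak : 𝓗.addDim + 𝓗.torusDim = d + 1 := (dimG_eq_addDim_add_torusDim H hirr).symm.trans hdim
    set a := 𝓗.addDim with hadef
    set k := 𝓗.torusDim with hkdef
    set S : ℕ := ∑ J ∈ (Finset.univ : Finset (Fin n)).powersetCard k,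
      ((H : Set (GaGm n)) ∩ {g : GaGm n | g.1 = 1 ∧ ∀ j ∈ J, g.2 j = 1}).ncard with hSdef
    -- level subgroups and their identity components
    have hKex : ∀ c : Fin (n + 1), ∃ K : Subgroup (GaGm n),
        (K : Set (GaGm n)) = {g : GaGm n | g ∈ H ∧ coord g c = coord (1 : GaGm n) c} :=
      fun c => exists_subgroup_coe_eq_level H c
    choose K hK using hKex
    have hKcl : ∀ c, IsClosedG (K c : Set (GaGm n)) := fun c => by
      rw [hK c]; exact isClosedG_level H hirr.isClosedG c
    have h𝒴ex : ∀ c, ∃ 𝒴 : Finset (Set (GaGm n)),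
        (∀ Y ∈ 𝒴, ∃ f ∈ K c, Y = f • ((idComp (K c) (hKcl c) : Subgroup (GaGm n)) : Set (GaGm n))) ∧
        (K c : Set (GaGm n)) = ⋃ Y ∈ 𝒴, Y := fun c => exists_cosets_idComp (K c) (hKcl c)
    choose 𝒴 h𝒴 hcov using h𝒴ex
    set K₀ : Fin (n + 1) → Subgroup (GaGm n) := fun c => idComp (K c) (hKcl c) with hK₀def
    have hK₀irr : ∀ c, IsIrred (K₀ c : Set (GaGm n)) := fun c => isIrred_idComp (K c) (hKcl c)
    have hK₀le : ∀ c, K₀ c ≤ K c := fun c => idComp_le (K c) (hKcl c)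
    have hKleH : ∀ c, K c ≤ H := fun c g hg => by
      have : g ∈ {g : GaGm n | g ∈ H ∧ coord g c = coord (1 : GaGm n) c} := (hK c) ▸ hg
      exact this.1
    have hKcoord : ∀ c, ∀ g ∈ K c, coord g c = coord (1 : GaGm n) c := fun c g hg => by
      have : g ∈ {g : GaGm n | g ∈ H ∧ coord g c = coord (1 : GaGm n) c} := (hK c) ▸ hg
      exact this.2
    -- good coordinates and multiplicities
    set good : Finset (Fin (n + 1)) := (Finset.univ : Finset (Fin (n + 1))).filter fun c =>
      Fin.cases (motive := fun _ => Prop) (𝓗.addPart = true)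
        (fun h => Pi.single h (1 : ℤ) ∉ charGroup (H : Set (GaGm n))) c with hgooddef
    have hgood0 : (0 : Fin (n + 1)) ∈ good ↔ 𝓗.addPart = true := by
      rw [hgooddef, Finset.mem_filter]; simp
    have hgoodS : ∀ h : Fin n, h.succ ∈ good ↔ Pi.single h (1 : ℤ) ∉ charGroup (H : Set (GaGm n)) := by
      intro h; rw [hgooddef, Finset.mem_filter]; simp
    set m : Fin (n + 1) → ℕ := fun c => Fin.cases (motive := fun _ => ℕ) D₀ (fun _ => D₁) c with hmdef
    have hm0 : m 0 = D₀ := by simp [hmdef]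
    have hmS : ∀ h : Fin n, m h.succ = D₁ := by intro h; simp [hmdef]
    -- infinitude of the good coordinates' images
    have hall : 𝓗.addPart = true → ∀ x : ℂ, ((Multiplicative.ofAdd x, 1) : GaGm n) ∈ H :=
      fun hadd x => mem_of_addPart H hirr hadd x H.one_mem
    have hinf : ∀ c ∈ good, ((fun g : GaGm n => coord g c) '' (H : Set (GaGm n))).Infinite := by
      intro c hc
      revert hc
      refine Fin.cases ?_ (fun h => ?_) c
      · intro hc; exact infinite_image_coord_zero H (hall (hgood0.mp hc))
      · intro hc; exact infinite_image_coord_succ H hirr h ((hgoodS h).mp hc)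
    -- the section points and the Bézout inequality
    obtain ⟨σ, h1, h2, h3, h4⟩ := exists_section_points H good m hinf (fun c => (K c : Set (GaGm n)))
    obtain ⟨hsum, hdimK₀⟩ := section_sum_le_mult hD₀ hD₁ H hirr hdim K hK hKcl 𝒴 h𝒴 hcov good m
      (le_of_eq hm0) (fun h => le_of_eq (hmS h)) σ h1 h2 h3 h4
    -- the additive dimension of the `K₀ c`
    have hone_notMem_K0 : ((Multiplicative.ofAdd (1 : ℂ), (1 : Fin n → ℂˣ)) : GaGm n) ∉ K₀ 0 := by
      intro hmem
      have := hKcoord 0 _ (hK₀le 0 hmem)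
      rw [coord_zero, coord_one_zero] at this
      simp at this
    have haddK0 : (toConnAlgSubgroup (K₀ 0) (hK₀irr 0)).addDim = 0 := by
      rw [addDim_toConnAlgSubgroup_eq, if_neg hone_notMem_K0]
    have haddKS : ∀ h : Fin n, h.succ ∈ good → (toConnAlgSubgroup (K₀ h.succ) (hK₀irr h.succ)).addDim = a := by
      intro h hh
      rw [addDim_toConnAlgSubgroup_eq, hadef, addDim_toConnAlgSubgroup_eq]
      by_cases hadd : ((Multiplicative.ofAdd (1 : ℂ), (1 : Fin n → ℂˣ)) : GaGm n) ∈ H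
      · -- the additive line lies in `K₀ h.succ`
        have hadd' : 𝓗.addPart = true := (addPart_toConnAlgSubgroup_iff H hirr).mpr hadd
        have hline : ({g : GaGm n | g.2 = 1} : Set (GaGm n)) ⊆ (K h.succ : Set (GaGm n)) := by
          intro g hg
          rw [hK]
          have hg1 : g.2 = 1 := hg
          refine ⟨?_, by rw [coord_succ, coord_one_succ, hg1]; rfl⟩
          have : g = ((Multiplicative.ofAdd (Multiplicative.toAdd g.1), 1) : GaGm n) := by ext <;> simp [hg1]
          rw [this]; exact hall hadd' _
        rw [hcov h.succ] at hline
        obtain ⟨Y, hY, hsubY⟩ := isIrred_addLine.exists_subset_of_subset_biUnion (𝒴 h.succ) (fun Y => Y)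
          (fun Y hY => by
            obtain ⟨f, -, hYf⟩ := h𝒴 h.succ Y hY
            rw [hYf]; exact (hK₀irr h.succ).isClosedG.smul f) hline
        obtain ⟨f, -, hYf⟩ := h𝒴 h.succ Y hY
        rw [hYf] at hsubY
        have h1Y : (1 : GaGm n) ∈ f • (K₀ h.succ : Set (GaGm n)) := hsubY (show (1 : GaGm n).2 = 1 from rfl)
        rw [smul_coe_eq_of_one_mem h1Y] at hsubY
        have : ((Multiplicative.ofAdd (1 : ℂ), (1 : Fin n → ℂˣ)) : GaGm n) ∈ K₀ h.succ :=
          hsubY (show ((Multiplicative.ofAdd (1 : ℂ), (1 : Fin n → ℂˣ)) : GaGm n).2 = 1 from rfl)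
        rw [if_pos this, if_pos hadd]
      · have hadd' : 𝓗.addPart = false := by
          rw [Bool.eq_false_iff]; exact fun h' => hadd ((addPart_toConnAlgSubgroup_iff H hirr).mp h')
        have : ((Multiplicative.ofAdd (1 : ℂ), (1 : Fin n → ℂˣ)) : GaGm n) ∉ K₀ h.succ := by
          intro hmem
          have := fst_eq_one_of_not_addPart H hirr hadd' (hKleH _ (hK₀le _ hmem))
          simp at this
        rw [if_neg this, if_neg hadd]
    -- the additive dimension `a` and the torus dimensions of the `K₀ c`
    have ha0 : (0 : Fin (n + 1)) ∈ good → a = 1 := fun h0 => by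
      rw [hadef, ConnAlgSubgroup.addDim, if_pos (hgood0.mp h0)]
    have ha0' : (0 : Fin (n + 1)) ∉ good → a = 0 := fun h0 => by
      rw [hadef, ConnAlgSubgroup.addDim, if_neg (fun h => h0 (hgood0.mpr h))]
    have hkK0 : (0 : Fin (n + 1)) ∈ good → (toConnAlgSubgroup (K₀ 0) (hK₀irr 0)).torusDim = k := fun h0 => by
      have h := dimG_eq_addDim_add_torusDim (K₀ 0) (hK₀irr 0)
      rw [hdimK₀ 0 h0, haddK0] at h
      have := ha0 h0
      omega
    have hkKS : ∀ h : Fin n, h.succ ∈ good →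
        (toConnAlgSubgroup (K₀ h.succ) (hK₀irr h.succ)).torusDim = k - 1 ∧ 1 ≤ k := fun h hh => by
      have h' := dimG_eq_addDim_add_torusDim (K₀ h.succ) (hK₀irr h.succ)
      rw [hdimK₀ h.succ hh, haddKS h hh] at h'
      omega
    -- slice inequalities
    have h𝒴' : ∀ c, ∀ Y ∈ 𝒴 c, ∃ f : GaGm n, Y = f • (K₀ c : Set (GaGm n)) := fun c Y hY => by
      obtain ⟨f, -, hf⟩ := h𝒴 c Y hY; exact ⟨f, hf⟩
    have hsl0 : ∀ J : Finset (Fin n),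
        ((H : Set (GaGm n)) ∩ {g : GaGm n | g.1 = 1 ∧ ∀ j ∈ J, g.2 j = 1}).ncard ≤
          (𝒴 0).card * ((K₀ 0 : Set (GaGm n)) ∩ {g : GaGm n | g.1 = 1 ∧ ∀ j ∈ J, g.2 j = 1}).ncard := by
      intro J
      rw [inter_slice_eq_level_zero H (K 0) (hK 0) J]
      exact ncard_inter_slice_le (K 0) (K₀ 0) (𝒴 0) (h𝒴' 0) (hcov 0) J
    have hslS : ∀ (h : Fin n) (J' : Finset (Fin n)),
        ((H : Set (GaGm n)) ∩ {g : GaGm n | g.1 = 1 ∧ ∀ j ∈ insert h J', g.2 j = 1}).ncard ≤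
          (𝒴 h.succ).card * ((K₀ h.succ : Set (GaGm n)) ∩ {g : GaGm n | g.1 = 1 ∧ ∀ j ∈ J', g.2 j = 1}).ncard := by
      intro h J'
      rw [inter_slice_insert_eq_level_succ H (K h.succ) h (hK h.succ) J']
      exact ncard_inter_slice_le (K h.succ) (K₀ h.succ) (𝒴 h.succ) (h𝒴' h.succ) (hcov h.succ) J'
    -- the induction hypothesis for the `K₀ c`
    have IH0 : (0 : Fin (n + 1)) ∈ good →
        d.factorial * (D₁ ^ k * ∑ J ∈ (Finset.univ : Finset (Fin n)).powersetCard k,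
          ((K₀ 0 : Set (GaGm n)) ∩ {g : GaGm n | g.1 = 1 ∧ ∀ j ∈ J, g.2 j = 1}).ncard) ≤
          mult D₀ D₁ (K₀ 0 : Set (GaGm n)) := fun h0 => by
      have h := IH (K₀ 0) (hK₀irr 0) (hdimK₀ 0 h0)
      rw [haddK0, hkK0 h0, pow_zero, one_mul] at h
      exact h
    have IHS : ∀ h : Fin n, h.succ ∈ good →
        d.factorial * (D₀ ^ a * (D₁ ^ (k - 1) * ∑ J' ∈ (Finset.univ : Finset (Fin n)).powersetCard (k - 1),
          ((K₀ h.succ : Set (GaGm n)) ∩ {g : GaGm n | g.1 = 1 ∧ ∀ j ∈ J', g.2 j = 1}).ncard)) ≤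
          mult D₀ D₁ (K₀ h.succ : Set (GaGm n)) := fun h hh => by
      have h' := IH (K₀ h.succ) (hK₀irr h.succ) (hdimK₀ h.succ hh)
      rw [haddKS h hh, (hkKS h hh).1] at h'
      exact h'
    -- the two kinds of terms
    set X : ℕ := d.factorial * (D₀ ^ a * (D₁ ^ k * S)) with hXdef
    have hterm0 : (0 : Fin (n + 1)) ∈ good → X ≤ m 0 * (𝒴 0).card * mult D₀ D₁ (K₀ 0 : Set (GaGm n)) := by
      intro h0
      have ha1 := ha0 h0
      calc X = D₀ * (d.factorial * (D₁ ^ k * S)) := by rw [hXdef, ha1, pow_one]; ring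
        _ ≤ D₀ * (d.factorial * (D₁ ^ k * ((𝒴 0).card * ∑ J ∈ (Finset.univ : Finset (Fin n)).powersetCard k,
              ((K₀ 0 : Set (GaGm n)) ∩ {g : GaGm n | g.1 = 1 ∧ ∀ j ∈ J, g.2 j = 1}).ncard))) := by
            gcongr
            rw [hSdef, Finset.mul_sum]
            exact Finset.sum_le_sum fun J _ => hsl0 J
        _ = m 0 * (𝒴 0).card * (d.factorial * (D₁ ^ k * ∑ J ∈ (Finset.univ : Finset (Fin n)).powersetCard k,
              ((K₀ 0 : Set (GaGm n)) ∩ {g : GaGm n | g.1 = 1 ∧ ∀ j ∈ J, g.2 j = 1}).ncard)) := by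
            rw [hm0]; ring
        _ ≤ m 0 * (𝒴 0).card * mult D₀ D₁ (K₀ 0 : Set (GaGm n)) := Nat.mul_le_mul_left _ (IH0 h0)
    have htermS : ∀ h : Fin n, h.succ ∈ good →
        d.factorial * (D₀ ^ a * (D₁ ^ k *
          ∑ J' ∈ ((Finset.univ : Finset (Fin n)).powersetCard (k - 1)).filter (fun J' => h ∉ J'),
            ((H : Set (GaGm n)) ∩ {g : GaGm n | g.1 = 1 ∧ ∀ j ∈ insert h J', g.2 j = 1}).ncard)) ≤
          m h.succ * (𝒴 h.succ).card * mult D₀ D₁ (K₀ h.succ : Set (GaGm n)) := by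
      intro h hh
      obtain ⟨-, hk1⟩ := hkKS h hh
      have hpow : D₁ ^ k = D₁ * D₁ ^ (k - 1) := by
        rw [← pow_succ', Nat.sub_add_cancel hk1]
      calc d.factorial * (D₀ ^ a * (D₁ ^ k *
            ∑ J' ∈ ((Finset.univ : Finset (Fin n)).powersetCard (k - 1)).filter (fun J' => h ∉ J'),
              ((H : Set (GaGm n)) ∩ {g : GaGm n | g.1 = 1 ∧ ∀ j ∈ insert h J', g.2 j = 1}).ncard))
          ≤ d.factorial * (D₀ ^ a * (D₁ ^ k * ((𝒴 h.succ).card *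
              ∑ J' ∈ (Finset.univ : Finset (Fin n)).powersetCard (k - 1),
                ((K₀ h.succ : Set (GaGm n)) ∩ {g : GaGm n | g.1 = 1 ∧ ∀ j ∈ J', g.2 j = 1}).ncard))) := by
            gcongr d.factorial * (D₀ ^ a * (D₁ ^ k * ?_))
            rw [Finset.mul_sum]
            exact (Finset.sum_le_sum fun J' _ => hslS h J').trans
              (Finset.sum_le_sum_of_subset (Finset.filter_subset _ _))
        _ = m h.succ * (𝒴 h.succ).card * (d.factorial * (D₀ ^ a * (D₁ ^ (k - 1) *
              ∑ J' ∈ (Finset.univ : Finset (Fin n)).powersetCard (k - 1),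
                ((K₀ h.succ : Set (GaGm n)) ∩ {g : GaGm n | g.1 = 1 ∧ ∀ j ∈ J', g.2 j = 1}).ncard))) := by
            rw [hmS, hpow]; ring
        _ ≤ m h.succ * (𝒴 h.succ).card * mult D₀ D₁ (K₀ h.succ : Set (GaGm n)) :=
            Nat.mul_le_mul_left _ (IHS h hh)
    -- the good torus coordinates and the combinatorial identity
    set goodY : Finset (Fin n) := (Finset.univ : Finset (Fin n)).filter fun h => h.succ ∈ good with hgoodYdef
    have hmemY : ∀ h, h ∈ goodY ↔ h.succ ∈ good := fun h => by rw [hgoodYdef, Finset.mem_filter]; simp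
    have hcomb : ∑ h ∈ goodY,
        ∑ J' ∈ ((Finset.univ : Finset (Fin n)).powersetCard (k - 1)).filter (fun J' => h ∉ J'),
          ((H : Set (GaGm n)) ∩ {g : GaGm n | g.1 = 1 ∧ ∀ j ∈ insert h J', g.2 j = 1}).ncard = k * S := by
      rcases Nat.eq_zero_or_pos k with hk0 | hkpos
      · have hempty : goodY = ∅ := by
          rw [Finset.eq_empty_iff_forall_notMem]
          intro h hh
          have := (hkKS h ((hmemY h).mp hh)).2
          omega
        rw [hempty, Finset.sum_empty, hk0, zero_mul]
      · obtain ⟨k', hk'⟩ : ∃ k', k = k' + 1 := ⟨k - 1, by omega⟩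
        have hG : ∀ h ∉ goodY, Pi.single h (1 : ℤ) ∈ charGroup (H : Set (GaGm n)) := by
          intro h hh
          rw [hmemY, hgoodS] at hh
          by_contra hc
          exact hh hc
        have hk'' : 𝓗.torusDim = k' + 1 := by rw [← hkdef, hk']
        have e1 : k - 1 = k' := by omega
        rw [e1, hSdef, hk']
        exact sum_sum_slice_insert_eq H hirr goodY hG hk''
    -- splitting the sum over `good` into `c = 0` and `c = h.succ`
    have hsplit : ∀ f : Fin (n + 1) → ℕ,
        ∑ c ∈ good, f c = (if (0 : Fin (n + 1)) ∈ good then f 0 else 0) + ∑ h ∈ goodY, f h.succ := by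
      intro f
      have h1 : ∑ c ∈ good, f c = ∑ c ∈ (Finset.univ : Finset (Fin (n + 1))), (if c ∈ good then f c else 0) := by
        rw [Finset.sum_ite_mem, Finset.univ_inter]
      rw [h1, Fin.sum_univ_succ, hgoodYdef, Finset.sum_filter]
    -- assembly
    have hX : (d + 1).factorial * (D₀ ^ a * (D₁ ^ k * S)) = a * X + k * X := by
      rw [Nat.factorial_succ, ← hak, hXdef]; ring
    rw [hX]
    calc a * X + k * X
        ≤ (if (0 : Fin (n + 1)) ∈ good then m 0 * (𝒴 0).card * mult D₀ D₁ (K₀ 0 : Set (GaGm n)) else 0) +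
            ∑ h ∈ goodY, m h.succ * (𝒴 h.succ).card * mult D₀ D₁ (K₀ h.succ : Set (GaGm n)) := by
          apply Nat.add_le_add
          · by_cases h0 : (0 : Fin (n + 1)) ∈ good
            · rw [if_pos h0, ha0 h0, one_mul]; exact hterm0 h0
            · rw [if_neg h0, ha0' h0, zero_mul]
          · calc k * X = d.factorial * (D₀ ^ a * (D₁ ^ k * (k * S))) := by rw [hXdef]; ring
              _ = ∑ h ∈ goodY, d.factorial * (D₀ ^ a * (D₁ ^ k *
                    ∑ J' ∈ ((Finset.univ : Finset (Fin n)).powersetCard (k - 1)).filter (fun J' => h ∉ J'),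
                      ((H : Set (GaGm n)) ∩ {g : GaGm n | g.1 = 1 ∧ ∀ j ∈ insert h J', g.2 j = 1}).ncard)) := by
                  rw [← hcomb]; simp only [Finset.mul_sum]
              _ ≤ ∑ h ∈ goodY, m h.succ * (𝒴 h.succ).card * mult D₀ D₁ (K₀ h.succ : Set (GaGm n)) :=
                  Finset.sum_le_sum fun h hh => htermS h ((hmemY h).mp hh)
      _ = ∑ c ∈ good, m c * (𝒴 c).card * mult D₀ D₁ (K₀ c : Set (GaGm n)) :=
          (hsplit (fun c => m c * (𝒴 c).card * mult D₀ D₁ (K₀ c : Set (GaGm n)))).symm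
      _ ≤ mult D₀ D₁ (H : Set (GaGm n)) := hsum

end GaGm

end Literature.NumberTheory.Transcendental
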